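import Mathlib.Combinatorics.Enumerative.DoubleCounting
import Mathlib.Data.Finset.Powerset
import Mathlib.Data.Nat.Choose.Basic
import Mathlib.Algebra.Order.BigOperators.Group.Finset
import Mathlib.Tactic

/-!
# PercRepro — WINDOW FAMILIES OF SUBSETS OF A TWO-COLOURED SET: the double counting between consecutive sizes
(p9, gen 22)

`L ⊔ R` a finite set with `|L| = p₁ + q₁`, `|R| = p₂ + q₂` (`q_i ≤ p_i`); the WINDOW FAMILY `winFam u` = the
`u`-subsets `X` with `q₁ ≤ |X ∩ L| ≤ p₁` and `q₂ ≤ |X ∩ R| ≤ p₂`. The inclusion graph between `winFam u` and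
`winFam (u + 1)`: every `u`-set has `n − u` supersets of size `u + 1` and every `(u + 1)`-set has `u + 1` subsets of
size `u` (`card_bipartiteAbove_insert_le`, `card_bipartiteBelow_erase_le` and the matching lower bounds when the
family is closed under the operation). Hence:
* **(R1)** for `q₁ + q₂ ≤ u` with `u + 1 ≤ q₁ + p₂` and `u + 1 ≤ p₁ + q₂` (the window is `[q₁, u − q₂]` and grows):
  `#winFam u · (n − u) ≤ #winFam (u + 1) · (u + 1)` (`card_winFam_mul_le_succ`);
* **(R2)** for `q₁ + p₂ ≤ u`, `p₁ + q₂ ≤ u`, `u + 1 ≤ p₁ + p₂` (the window is `[u − p₂, p₁]` and shrinks):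
  `#winFam (u + 1) · (u + 1) ≤ #winFam u · (n − u)` (`card_winFam_succ_mul_le`).
In the probability `π(u) = #winFam u / C(n, u)` these say `π` is non-decreasing below `min(q₁ + p₂, p₁ + q₂)` and
non-increasing above `max(q₁ + p₂, p₁ + q₂)` (`C(n, u + 1)(u + 1) = C(n, u)(n − u)`). The middle regime is
`RankDistWindowMiddle`; the inequality `π(u) ≥ π(q₁ + q₂)` for all `q₁ + q₂ ≤ u ≤ p₁ + p₂` — the RESTRICTED
VANDERMONDE INEQUALITY behind the direct-sum closure of the row (SC) — is assembled in
`RankDistRestrictedVandermonde`. Nothing here moves any window of the crux.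
-/

namespace PercRepro.RankDist

open Finset

variable {α : Type} [DecidableEq α]

/-! ## The inclusion graph between consecutive sizes -/

/-- A `u`-subset `X` of `U` has at most `|U| − u` supersets of size `u + 1` in any family: they are the
`insert x X`, `x ∈ U ∖ X`. -/
lemma card_bipartiteAbove_insert_le {U : Finset α} {u : ℕ} (ℬ : Finset (Finset α))
    (hℬ : ℬ ⊆ U.powersetCard (u + 1)) {X : Finset α} (hX : X ∈ U.powersetCard u) :
    (ℬ.bipartiteAbove (fun X X' => X ⊆ X') X).card ≤ U.card - u := by
  rw [mem_powersetCard] at hX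
  have hsub : ℬ.bipartiteAbove (fun X X' => X ⊆ X') X ⊆ (U \ X).image (fun x => insert x X) := by
    intro X' hX'
    rw [mem_bipartiteAbove] at hX'
    obtain ⟨hX'ℬ, hXX'⟩ := hX'
    have hX'U := mem_powersetCard.1 (hℬ hX'ℬ)
    have hcard : (X' \ X).card = 1 := by
      rw [card_sdiff_of_subset hXX', hX'U.2, hX.2]
      omega
    obtain ⟨y, hy⟩ := card_eq_one.1 hcard
    rw [mem_image]
    refine ⟨y, ?_, ?_⟩
    · have hyX' : y ∈ X' \ X := by
        rw [hy]
        exact mem_singleton_self y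
      rw [mem_sdiff] at hyX' ⊢
      exact ⟨hX'U.1 hyX'.1, hyX'.2⟩
    · ext z
      rw [mem_insert]
      constructor
      · rintro (rfl | hz)
        · have : z ∈ X' \ X := by
            rw [hy]
            exact mem_singleton_self z
          exact (mem_sdiff.1 this).1
        · exact hXX' hz
      · intro hz
        by_cases hzX : z ∈ X
        · exact Or.inr hzX
        · left
          have : z ∈ X' \ X := mem_sdiff.2 ⟨hz, hzX⟩
          rw [hy, mem_singleton] at this
          exact this
  calc (ℬ.bipartiteAbove (fun X X' => X ⊆ X') X).card
      ≤ ((U \ X).image (fun x => insert x X)).card := card_le_card hsub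
    _ ≤ (U \ X).card := card_image_le
    _ = U.card - u := by rw [card_sdiff_of_subset hX.1, hX.2]

/-- A `(u + 1)`-set `X'` has at most `u + 1` subsets of size `u` in any family: they are the `X'.erase y`,
`y ∈ X'`. -/
lemma card_bipartiteBelow_erase_le {U : Finset α} {u : ℕ} (𝒜 : Finset (Finset α))
    (h𝒜 : 𝒜 ⊆ U.powersetCard u) {X' : Finset α} (hX' : X' ∈ U.powersetCard (u + 1)) :
    (𝒜.bipartiteBelow (fun X X' => X ⊆ X') X').card ≤ u + 1 := by
  rw [mem_powersetCard] at hX'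
  have hsub : 𝒜.bipartiteBelow (fun X X' => X ⊆ X') X' ⊆ X'.image (fun y => X'.erase y) := by
    intro X hX
    rw [mem_bipartiteBelow] at hX
    obtain ⟨hX𝒜, hXX'⟩ := hX
    have hXU := mem_powersetCard.1 (h𝒜 hX𝒜)
    have hcard : (X' \ X).card = 1 := by
      rw [card_sdiff_of_subset hXX', hX'.2, hXU.2]
      omega
    obtain ⟨y, hy⟩ := card_eq_one.1 hcard
    have hyX' : y ∈ X' \ X := by
      rw [hy]
      exact mem_singleton_self y
    rw [mem_sdiff] at hyX'
    rw [mem_image]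
    refine ⟨y, hyX'.1, ?_⟩
    ext z
    rw [mem_erase]
    constructor
    · rintro ⟨hzy, hz⟩
      by_contra hzX
      have : z ∈ X' \ X := mem_sdiff.2 ⟨hz, hzX⟩
      rw [hy, mem_singleton] at this
      exact hzy this
    · intro hz
      refine ⟨fun h => hyX'.2 (h ▸ hz), hXX' hz⟩
  calc (𝒜.bipartiteBelow (fun X X' => X ⊆ X') X').card
      ≤ (X'.image (fun y => X'.erase y)).card := card_le_card hsub
    _ ≤ X'.card := card_image_le
    _ = u + 1 := hX'.2

/-- If every `insert x X` (`x ∈ U ∖ X`) lies in `ℬ`, the `u`-set `X ⊆ U` has at least `|U| − u` supersets in `ℬ`. -/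
lemma le_card_bipartiteAbove_insert {U : Finset α} {u : ℕ} (ℬ : Finset (Finset α)) {X : Finset α}
    (hX : X ∈ U.powersetCard u) (hclosed : ∀ x ∈ U \ X, insert x X ∈ ℬ) :
    U.card - u ≤ (ℬ.bipartiteAbove (fun X X' => X ⊆ X') X).card := by
  rw [mem_powersetCard] at hX
  have hsub : (U \ X).image (fun x => insert x X) ⊆ ℬ.bipartiteAbove (fun X X' => X ⊆ X') X := by
    intro X' hX'
    rw [mem_image] at hX'
    obtain ⟨x, hx, rfl⟩ := hX'
    rw [mem_bipartiteAbove]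
    exact ⟨hclosed x hx, subset_insert x X⟩
  have hinj : Set.InjOn (fun x => insert x X) (U \ X : Finset α) := by
    intro x hx y hy hxy
    rw [coe_sdiff, Set.mem_sdiff, mem_coe, mem_coe] at hx hy
    dsimp only at hxy
    have : x ∈ insert y X := by
      rw [← hxy]
      exact mem_insert_self x X
    rw [mem_insert] at this
    rcases this with h | h
    · exact h
    · exact absurd h hx.2
  calc U.card - u = (U \ X).card := by rw [card_sdiff_of_subset hX.1, hX.2]
    _ = ((U \ X).image (fun x => insert x X)).card := (card_image_of_injOn hinj).symm
    _ ≤ (ℬ.bipartiteAbove (fun X X' => X ⊆ X') X).card := card_le_card hsub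

/-- If every `X'.erase y` (`y ∈ X'`) lies in `𝒜`, the `(u + 1)`-set `X'` has at least `u + 1` subsets in `𝒜`. -/
lemma le_card_bipartiteBelow_erase {U : Finset α} {u : ℕ} (𝒜 : Finset (Finset α)) {X' : Finset α}
    (hX' : X' ∈ U.powersetCard (u + 1)) (hclosed : ∀ y ∈ X', X'.erase y ∈ 𝒜) :
    u + 1 ≤ (𝒜.bipartiteBelow (fun X X' => X ⊆ X') X').card := by
  rw [mem_powersetCard] at hX'
  have hsub : X'.image (fun y => X'.erase y) ⊆ 𝒜.bipartiteBelow (fun X X' => X ⊆ X') X' := by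
    intro X hX
    rw [mem_image] at hX
    obtain ⟨y, hy, rfl⟩ := hX
    rw [mem_bipartiteBelow]
    exact ⟨hclosed y hy, erase_subset y X'⟩
  have hinj : Set.InjOn (fun y => X'.erase y) (X' : Finset α) := by
    intro x hx y hy hxy
    rw [mem_coe] at hx hy
    dsimp only at hxy
    by_contra hne
    have : x ∈ X'.erase y := mem_erase.2 ⟨hne, hx⟩
    rw [← hxy, mem_erase] at this
    exact this.1 rfl
  calc u + 1 = X'.card := hX'.2.symm
    _ = (X'.image (fun y => X'.erase y)).card := (card_image_of_injOn hinj).symm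
    _ ≤ (𝒜.bipartiteBelow (fun X X' => X ⊆ X') X').card := card_le_card hsub

/-! ## The window family -/

/-- The window family: the `u`-subsets of `L ∪ R` with between `q₁` and `p₁` elements of `L` and between `q₂` and
`p₂` elements of `R`. -/
def winFam (L R : Finset α) (q₁ p₁ q₂ p₂ u : ℕ) : Finset (Finset α) :=
  ((L ∪ R).powersetCard u).filter
    (fun X => q₁ ≤ (X ∩ L).card ∧ (X ∩ L).card ≤ p₁ ∧ q₂ ≤ (X ∩ R).card ∧ (X ∩ R).card ≤ p₂)

/-- Membership in the window family. -/
lemma mem_winFam {L R : Finset α} {q₁ p₁ q₂ p₂ u : ℕ} {X : Finset α} :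
    X ∈ winFam L R q₁ p₁ q₂ p₂ u ↔ X ⊆ L ∪ R ∧ X.card = u ∧
      q₁ ≤ (X ∩ L).card ∧ (X ∩ L).card ≤ p₁ ∧ q₂ ≤ (X ∩ R).card ∧ (X ∩ R).card ≤ p₂ := by
  unfold winFam
  rw [mem_filter, mem_powersetCard, and_assoc]

/-- The window family consists of `u`-subsets of `L ∪ R`. -/
lemma winFam_subset_powersetCard (L R : Finset α) (q₁ p₁ q₂ p₂ u : ℕ) :
    winFam L R q₁ p₁ q₂ p₂ u ⊆ (L ∪ R).powersetCard u :=
  filter_subset _ _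

/-- The two colour counts of a subset of `L ∪ R` add up to its size (`L`, `R` disjoint). -/
lemma card_inter_add_card_inter {L R : Finset α} (hLR : Disjoint L R) {X : Finset α} (hX : X ⊆ L ∪ R) :
    (X ∩ L).card + (X ∩ R).card = X.card := by
  rw [← card_union_of_disjoint (hLR.mono inter_subset_right inter_subset_right), ← inter_union_distrib_left,
    inter_eq_left.2 hX]

/-- Inserting an element of `L` raises the `L`-count by one and keeps the `R`-count (`L`, `R` disjoint). -/
lemma card_inter_insert_of_mem_left {L R : Finset α} (hLR : Disjoint L R) {X : Finset α} {x : α}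
    (hx : x ∈ L) (hxX : x ∉ X) :
    ((insert x X) ∩ L).card = (X ∩ L).card + 1 ∧ ((insert x X) ∩ R).card = (X ∩ R).card := by
  constructor
  · rw [insert_inter_of_mem hx, card_insert_of_notMem (fun h => hxX (mem_inter.1 h).1)]
  · rw [insert_inter_of_notMem (disjoint_left.1 hLR hx)]

/-- Inserting an element of `R` raises the `R`-count by one and keeps the `L`-count (`L`, `R` disjoint). -/
lemma card_inter_insert_of_mem_right {L R : Finset α} (hLR : Disjoint L R) {X : Finset α} {x : α}
    (hx : x ∈ R) (hxX : x ∉ X) :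
    ((insert x X) ∩ L).card = (X ∩ L).card ∧ ((insert x X) ∩ R).card = (X ∩ R).card + 1 := by
  constructor
  · rw [insert_inter_of_notMem (disjoint_right.1 hLR hx)]
  · rw [insert_inter_of_mem hx, card_insert_of_notMem (fun h => hxX (mem_inter.1 h).1)]

/-- Erasing an element of `L` lowers the `L`-count by one and keeps the `R`-count. -/
lemma card_inter_erase_of_mem_left {L R : Finset α} (hLR : Disjoint L R) {X' : Finset α} {y : α}
    (hy : y ∈ L) (hyX : y ∈ X') :
    ((X'.erase y) ∩ L).card + 1 = (X' ∩ L).card ∧ ((X'.erase y) ∩ R).card = (X' ∩ R).card := by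
  constructor
  · rw [erase_inter, card_erase_add_one (mem_inter.2 ⟨hyX, hy⟩)]
  · rw [erase_inter, erase_eq_of_notMem (fun h => disjoint_left.1 hLR hy (mem_inter.1 h).2)]

/-- Erasing an element of `R` lowers the `R`-count by one and keeps the `L`-count. -/
lemma card_inter_erase_of_mem_right {L R : Finset α} (hLR : Disjoint L R) {X' : Finset α} {y : α}
    (hy : y ∈ R) (hyX : y ∈ X') :
    ((X'.erase y) ∩ L).card = (X' ∩ L).card ∧ ((X'.erase y) ∩ R).card + 1 = (X' ∩ R).card := by
  constructor
  · rw [erase_inter, erase_eq_of_notMem (fun h => disjoint_right.1 hLR hy (mem_inter.1 h).2)]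
  · rw [erase_inter, card_erase_add_one (mem_inter.2 ⟨hyX, hy⟩)]

/-! ## (R1): below `min(q₁ + p₂, p₁ + q₂)` the window grows -/

/-- **(R1)**: for `u + 1 ≤ q₁ + p₂` and `u + 1 ≤ p₁ + q₂`, every superset `insert x X` of a member of
`winFam u` is a member of `winFam (u + 1)`, so `#winFam u · (n − u) ≤ #winFam (u + 1) · (u + 1)`. -/
theorem card_winFam_mul_le_succ {L R : Finset α} (hLR : Disjoint L R) {q₁ p₁ q₂ p₂ u : ℕ}
    (hu₁ : u + 1 ≤ q₁ + p₂) (hu₂ : u + 1 ≤ p₁ + q₂) :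
    (winFam L R q₁ p₁ q₂ p₂ u).card * ((L ∪ R).card - u)
      ≤ (winFam L R q₁ p₁ q₂ p₂ (u + 1)).card * (u + 1) := by
  refine card_mul_le_card_mul (fun X X' => X ⊆ X') (fun X hX => ?_)
    (fun X' hX' => card_bipartiteBelow_erase_le _ (winFam_subset_powersetCard L R q₁ p₁ q₂ p₂ u)
      (winFam_subset_powersetCard L R q₁ p₁ q₂ p₂ (u + 1) hX'))
  refine le_card_bipartiteAbove_insert _ (winFam_subset_powersetCard L R q₁ p₁ q₂ p₂ u hX) ?_
  intro x hx
  rw [mem_sdiff] at hx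
  obtain ⟨hXLR, hXu, h1, h2, h3, h4⟩ := mem_winFam.1 hX
  have hsum := card_inter_add_card_inter hLR hXLR
  rw [mem_winFam]
  refine ⟨insert_subset hx.1 hXLR, by rw [card_insert_of_notMem hx.2, hXu], ?_⟩
  rcases mem_union.1 hx.1 with hxL | hxR
  · obtain ⟨e1, e2⟩ := card_inter_insert_of_mem_left hLR hxL hx.2
    rw [e1, e2]
    omega
  · obtain ⟨e1, e2⟩ := card_inter_insert_of_mem_right hLR hxR hx.2
    rw [e1, e2]
    omega

/-! ## (R2): above `max(q₁ + p₂, p₁ + q₂)` the window shrinks -/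

/-- **(R2)**: for `q₁ + p₂ ≤ u` and `p₁ + q₂ ≤ u`, every subset `X'.erase y` of a member of
`winFam (u + 1)` is a member of `winFam u`, so `#winFam (u + 1) · (u + 1) ≤ #winFam u · (n − u)`. -/
theorem card_winFam_succ_mul_le {L R : Finset α} (hLR : Disjoint L R) {q₁ p₁ q₂ p₂ u : ℕ}
    (hu₁ : q₁ + p₂ ≤ u) (hu₂ : p₁ + q₂ ≤ u) :
    (winFam L R q₁ p₁ q₂ p₂ (u + 1)).card * (u + 1)
      ≤ (winFam L R q₁ p₁ q₂ p₂ u).card * ((L ∪ R).card - u) := by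
  refine card_mul_le_card_mul' (fun X X' => X ⊆ X') (fun X' hX' => ?_)
    (fun X hX => card_bipartiteAbove_insert_le _ (winFam_subset_powersetCard L R q₁ p₁ q₂ p₂ (u + 1))
      (winFam_subset_powersetCard L R q₁ p₁ q₂ p₂ u hX))
  refine le_card_bipartiteBelow_erase _ (winFam_subset_powersetCard L R q₁ p₁ q₂ p₂ (u + 1) hX') ?_
  intro y hy
  obtain ⟨hXLR, hXu, h1, h2, h3, h4⟩ := mem_winFam.1 hX'
  have hsum := card_inter_add_card_inter hLR hXLR
  rw [mem_winFam]
  refine ⟨(erase_subset y X').trans hXLR, by rw [card_erase_of_mem hy, hXu]; rfl, ?_⟩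
  rcases mem_union.1 (hXLR hy) with hyL | hyR
  · obtain ⟨e1, e2⟩ := card_inter_erase_of_mem_left hLR hyL hy
    rw [e2]
    omega
  · obtain ⟨e1, e2⟩ := card_inter_erase_of_mem_right hLR hyR hy
    rw [e1]
    omega

end PercRepro.RankDist
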